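import Summits.CriticalPhenomena.CardyFormulaZ2.Theses.CardyWhiteToColoured
import Literature.MathematicalPhysics.QuantumLattice.EuclideanAction
import Literature.MathematicalPhysics.QuantumLattice.RandomFieldExtProofs
import Literature.MathematicalPhysics.QuantumFieldTheory.OSAxiomsFreeFieldGaussianProofs
import Literature.Probability.Percolation.FKLoopNestingEnergySimilarity
import HarnessLib

/-!
# `EuclideanCovariance` (route CardyWhiteToColoured, item stmt-CriticalPhenomena-4600)

The continuum family of the route — crossings of a conformal rectangle by the positive set of a
white noise `μ` on `ℂ` smoothed by the Gaussian bump of width `ℓ` — is an exact orbit of the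
similarity group: if `R'` has carrier and arcs `0`, `2` equal to the images of those of `R` under
`S z = a z + w` (`a ≠ 0`), then the `μ`-probability that `R̄'` is crossed at width `‖a‖ ℓ` equals
the `μ`-probability that `R̄` is crossed at width `ℓ`.

Proof. Let `T f = ‖a‖⁻¹ • (f ∘ S⁻¹)` on `𝓢(ℂ, ℝ)` and `Φ = Tᵗ` its transpose on
`𝒮'(ℂ) = FieldConfig ℂ` (`FieldConfig.act T`).
* `Φ_* μ = μ`: the generating functional of `Φ_* μ` is `f ↦ S_μ(T f) = exp (-½ ∫ (T f)²)`
  (`genFunctional_map_act`) and `∫ (T f)² = ‖a‖⁻² · ‖a‖² ∫ f² = ∫ f²` by the planar change of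
  variables `∫ F(a⁻¹ z + b) dz = ‖a‖² ∫ F` (`integral_comp_similarity`); a finite Borel measure on
  `𝒮'` is determined by its generating functional (`ext_of_genFunctional_holds`, Minlos
  uniqueness, Gel'fand–Vilenkin IV §4).
* `T (k ℓ z) = ‖a‖⁻¹ • k (‖a‖ ℓ) (S z)` pointwise, so `(Φ ω)(k ℓ z) > 0 ↔ ω (k (‖a‖ℓ) (S z)) > 0`,
  and transporting paths along the homeomorphism `S` gives `Φ ⁻¹' E_{R,ℓ} = E_{R',‖a‖ℓ}`.
* `Φ` is a measurable equivalence (inverse `(T⁻¹)ᵗ`), so `μ (Φ ⁻¹' E) = (Φ_* μ) E = μ E` for every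
  set `E`, measurable or not (`MeasurableEquiv.map_apply`).
Glimm–Jaffe, *Quantum Physics* (1987) §6.2 (Gaussian measures on `𝒮'`, Euclidean covariance of
white noise).
-/

noncomputable section

open MeasureTheory Set
open scoped SchwartzMap
open Literature.MathematicalPhysics.QuantumLattice

namespace Summit.CriticalPhenomena.CardyFormulaZ2.Theorems

/-- **Similarity covariance of smoothed white-noise crossings** (item stmt-CriticalPhenomena-4600,
route CardyWhiteToColoured): for a white noise `μ` on `ℂ`, the Gaussian bump family
`k ℓ x = exp (-‖· - x‖² / (2ℓ²))`, conformal rectangles `R`, `R'` with `R'` the image of `R` under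
`z ↦ a z + w` (`a ≠ 0`) on carrier and arcs `0`, `2`, and every `ℓ > 0`, the `μ`-probability that
`R̄'` is crossed by `{ω (k (‖a‖ℓ) ·) > 0}` equals the `μ`-probability that `R̄` is crossed by
`{ω (k ℓ ·) > 0}`. Glimm–Jaffe §6.2. -/
theorem euclideanCovariance_proof :
    Summit.CriticalPhenomena.CardyFormulaZ2.Theses.CardyWhiteToColoured.EuclideanCovariance := by
  unfold Summit.CriticalPhenomena.CardyFormulaZ2.Theses.CardyWhiteToColoured.EuclideanCovariance
  intro μ hμ hgen k hk R R' a w ha hcar h0 h2 ℓ hℓ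
  have hna : ‖a‖ ≠ 0 := norm_ne_zero_iff.2 ha
  have hna' : 0 < ‖a‖ := norm_pos_iff.2 ha
  -- the real-linear automorphisms of `ℂ` given by multiplication by `a⁻¹` and by `a`
  obtain ⟨M, hM⟩ : ∃ M : ℂ ≃L[ℝ] ℂ, ∀ y, M y = a⁻¹ * y :=
    ⟨((LinearEquiv.smulOfNeZero ℂ ℂ a⁻¹ (inv_ne_zero ha)).restrictScalars ℝ).toContinuousLinearEquiv,
      fun y => rfl⟩
  obtain ⟨M', hM'⟩ : ∃ M' : ℂ ≃L[ℝ] ℂ, ∀ y, M' y = a * y :=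
    ⟨((LinearEquiv.smulOfNeZero ℂ ℂ a ha).restrictScalars ℝ).toContinuousLinearEquiv,
      fun y => rfl⟩
  -- `T f = ‖a‖⁻¹ • (f ∘ S⁻¹)` and its inverse `T' f = ‖a‖ • (f ∘ S)`, `S z = a z + w`
  obtain ⟨T, hT⟩ : ∃ T : 𝓢(ℂ, ℝ) →L[ℝ] 𝓢(ℂ, ℝ), ∀ f y, T f y = ‖a‖⁻¹ * f (a⁻¹ * (y - w)) := by
    refine ⟨‖a‖⁻¹ • ((SchwartzMap.compSubConstCLM ℝ w).comp
      (SchwartzMap.compCLMOfContinuousLinearEquiv ℝ M)), fun f y => ?_⟩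
    show ‖a‖⁻¹ • f (M (y - w)) = _
    rw [hM]
    rfl
  obtain ⟨T', hT'⟩ : ∃ T' : 𝓢(ℂ, ℝ) →L[ℝ] 𝓢(ℂ, ℝ), ∀ f y, T' f y = ‖a‖ * f (a * y + w) := by
    refine ⟨‖a‖ • ((SchwartzMap.compCLMOfContinuousLinearEquiv ℝ M').comp
      (SchwartzMap.compSubConstCLM ℝ (-w))), fun f y => ?_⟩
    show ‖a‖ • f (M' y - -w) = _
    rw [hM', sub_neg_eq_add]
    rfl
  have hTT' : ∀ f, T (T' f) = f := fun f => by
    ext y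
    rw [hT, hT', mul_inv_cancel_left₀ ha, sub_add_cancel, inv_mul_cancel_left₀ hna]
  have hT'T : ∀ f, T' (T f) = f := fun f => by
    ext y
    rw [hT', hT, add_sub_cancel_right, inv_mul_cancel_left₀ ha, mul_inv_cancel_left₀ hna]
  -- the transpose `Φ = Tᵗ` as a measurable equivalence of `𝒮'(ℂ)`
  let e : FieldConfig ℂ ≃ᵐ FieldConfig ℂ :=
    { toFun := FieldConfig.act T
      invFun := FieldConfig.act T'
      left_inv := fun ω => by
        ext f
        simp only [FieldConfig.act_apply, hTT']
      right_inv := fun ω => by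
        ext f
        simp only [FieldConfig.act_apply, hT'T]
      measurable_toFun := FieldConfig.measurable_act T
      measurable_invFun := FieldConfig.measurable_act T' }
  -- (1) invariance of white noise under `Φ`
  have hinv : μ.map (FieldConfig.act T) = μ := by
    haveI : IsProbabilityMeasure μ := hμ.1.toIsProbabilityMeasure
    refine ext_of_genFunctional_holds (funext fun f => ?_)
    rw [Literature.MathematicalPhysics.QuantumFieldTheory.genFunctional_map_act, hgen, hgen]
    have hI : ∫ z, (T f) z ^ 2 = ∫ z, f z ^ 2 := by
      have h1 : ∀ z, (T f) z ^ 2 = ‖a‖⁻¹ ^ 2 * f (a⁻¹ * z + -(a⁻¹ * w)) ^ 2 := fun z => by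
        rw [hT, mul_pow, mul_sub, sub_eq_add_neg]
      simp_rw [h1]
      have h2 := Literature.Probability.Percolation.integral_comp_similarity (fun u => f u ^ 2)
        (inv_ne_zero ha) (-(a⁻¹ * w))
      rw [integral_const_mul, h2, norm_inv, inv_pow, inv_inv, ← mul_assoc,
        inv_mul_cancel₀ (pow_ne_zero 2 hna), one_mul]
    rw [hI]
  -- (2) the kernel identity `T (k ℓ z) = ‖a‖⁻¹ • k (‖a‖ ℓ) (S z)`
  have hTk : ∀ z, T (k ℓ z) = ‖a‖⁻¹ • k (‖a‖ * ℓ) (a * z + w) := fun z => by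
    ext y
    rw [hT, smul_apply, smul_eq_mul, hk ℓ hℓ, hk (‖a‖ * ℓ) (mul_pos hna' hℓ)]
    congr 2
    have h3 : a⁻¹ * (y - w) - z = a⁻¹ * (y - (a * z + w)) := by
      rw [show y - (a * z + w) = (y - w) - a * z by ring, mul_sub a⁻¹ (y - w) (a * z),
        inv_mul_cancel_left₀ ha]
    rw [h3, norm_mul, norm_inv]
    ring
  have key : ∀ (ω : FieldConfig ℂ) (z : ℂ),
      0 < FieldConfig.act T ω (k ℓ z) ↔ 0 < ω (k (‖a‖ * ℓ) (a * z + w)) := fun ω z => by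
    rw [FieldConfig.act_apply, hTk z, map_smul, smul_eq_mul]
    exact mul_pos_iff_of_pos_left (inv_pos.2 hna')
  -- (3) the set identity `Φ ⁻¹' E_{R,ℓ} = E_{R',‖a‖ℓ}`
  have hS : Continuous fun z : ℂ => a * z + w := by fun_prop
  have hS' : Continuous fun y : ℂ => a⁻¹ * (y - w) := by fun_prop
  have hSS' : ∀ y, a * (a⁻¹ * (y - w)) + w = y := fun y => by
    rw [mul_inv_cancel_left₀ ha, sub_add_cancel]
  have hS'S : ∀ z, a⁻¹ * ((a * z + w) - w) = z := fun z => by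
    rw [add_sub_cancel_right, inv_mul_cancel_left₀ ha]
  have hset : FieldConfig.act T ⁻¹'
      {ω : FieldConfig ℂ | ∃ x ∈ R.arc 0, ∃ y ∈ R.arc 2, ∃ γ : Path x y,
        ∀ t, γ t ∈ closure R.carrier ∧ 0 < ω (k ℓ (γ t))} =
      {ω : FieldConfig ℂ | ∃ x ∈ R'.arc 0, ∃ y ∈ R'.arc 2, ∃ γ : Path x y,
        ∀ t, γ t ∈ closure R'.carrier ∧ 0 < ω (k (‖a‖ * ℓ) (γ t))} := by
    ext ω
    simp only [Set.mem_preimage, Set.mem_setOf_eq]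
    constructor
    · rintro ⟨x, hx, y, hy, γ, hγ⟩
      refine ⟨a * x + w, ?_, a * y + w, ?_, γ.map hS, fun t => ⟨?_, ?_⟩⟩
      · rw [h0]; exact ⟨x, hx, rfl⟩
      · rw [h2]; exact ⟨y, hy, rfl⟩
      · rw [hcar, Path.map_coe, Function.comp_apply]
        exact image_closure_subset_closure_image hS ⟨γ t, (hγ t).1, rfl⟩
      · rw [Path.map_coe, Function.comp_apply]
        exact (key ω (γ t)).1 (hγ t).2
    · rintro ⟨x', hx', y', hy', γ', hγ'⟩
      rw [h0] at hx'
      rw [h2] at hy'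
      obtain ⟨x, hx, rfl⟩ := hx'
      obtain ⟨y, hy, rfl⟩ := hy'
      refine ⟨a⁻¹ * ((a * x + w) - w), by rwa [hS'S], a⁻¹ * ((a * y + w) - w), by rwa [hS'S],
        γ'.map hS', fun t => ⟨?_, ?_⟩⟩
      · rw [Path.map_coe, Function.comp_apply]
        have hsub : (fun y : ℂ => a⁻¹ * (y - w)) '' closure R'.carrier ⊆ closure R.carrier := by
          refine (image_closure_subset_closure_image hS').trans (subset_of_eq ?_)
          rw [hcar, Set.image_image]
          congr 1
          ext z
          simp only [hS'S, Set.mem_image, exists_eq_right]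
        exact hsub ⟨γ' t, (hγ' t).1, rfl⟩
      · rw [Path.map_coe, Function.comp_apply, key ω, hSS']
        exact (hγ' t).2
  -- (4) conclusion
  have hmap : μ.map (FieldConfig.act T)
      {ω : FieldConfig ℂ | ∃ x ∈ R.arc 0, ∃ y ∈ R.arc 2, ∃ γ : Path x y,
        ∀ t, γ t ∈ closure R.carrier ∧ 0 < ω (k ℓ (γ t))} =
      μ (FieldConfig.act T ⁻¹'
        {ω : FieldConfig ℂ | ∃ x ∈ R.arc 0, ∃ y ∈ R.arc 2, ∃ γ : Path x y,
          ∀ t, γ t ∈ closure R.carrier ∧ 0 < ω (k ℓ (γ t))}) :=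
    MeasurableEquiv.map_apply e _
  rw [hinv, hset] at hmap
  simp only [Measure.real, hmap]

end Summit.CriticalPhenomena.CardyFormulaZ2.Theorems

end
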